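import Literature.Analysis.InnerProduct.ClosedHilbertComplexHodgeTheory
import Literature.Analysis.InnerProduct.HilbertComplexBasicEstimate
import HarnessLib

/-!
# Closed range of the Laplacian of a Hilbert complex: `Im □` is closed ⇔ `Im T` and `Im S` are closed ⇔
# Hörmander's basic estimate (1.1.4) ⇔ the spectral gap `‖u‖ ≤ c‖□u‖` on `D_□ ∩ 𝔥^⊥`
# (Brüning–Lesch 1992 Thm 2.4 / (2.20); Hörmander 1965 Thms 1.1.1–1.1.2 applied to the self-adjoint `□`)

Layer `Literature/Analysis/InnerProduct`, namespace `Literature.Analysis.InnerProduct`; sequel BY NAME of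
`HilbertComplexLaplacian.lean` (row g31-#1: `re_inner_laplacian_self`, `dense_laplacian_domain`,
`isClosed_laplacian`, `adjoint_laplacian_eq`), `ClosedHilbertComplexHodgeTheory.lean` (row g31-#2:
`closure_range_laplacian_eq_orthogonal_pmapKer`, `isClosed_range_laplacian`) and `HilbertComplexBasicEstimate.lean`
(row g31-#7: Hörmander's Theorem 1.1.1 `exists_estimate_of_isClosed_range` /
`isClosed_range_of_estimate_closure_range_adjoint` and Theorem 1.1.2 `isClosed_range_of_basic_estimate` /
`exists_basic_estimate_of_isClosed_range`), with `ClosedDenselyDefinedHilbertComplex.lean` (the orthogonalities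
of the weak Hodge decomposition) and `ClosedRangeTheoremHilbert.lean` (Kato IV 5.13). Lane `lit-hodgefound`
(Track 2 foundations library), prover seat `lit-hodgefound-p06` (generation 31), self-proposed row g31-#10.
THEOREMS ONLY (no definition, no named fact); `□ = TT* + S*S` is any `L : F →ₗ.[𝕜] F` with the hypotheses
`hdom`/`hval`, `𝔥 = Ker S ⊓ Ker T*`.

## Sources, verbatim

J. Brüning, M. Lesch, *Hilbert complexes*, J. Funct. Anal. 108 (1992), §2, proof of Theorem 2.4 (held text
`paper:doi-10-1016-0022-1236-92-90147-b`, p0006–p0007): "(2) ⇒ (3). If `Ĥ_i` has finite dimension for all `i`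
then `B̄_{i−1}` is closed in `ker D_i` hence closed in `H_i`. Thus we obtain from (2.9) and the closed range
theorem `H_i = Ĥ_i ⊕ B_{i−1} ⊕ B*_i` (2.17) … On the other hand, the weak Hodge decomposition implies
`im D = ⊕_{i≥0} (B̄_i ⊕ B̄*_{i+1})` (2.20), so `im D` is closed. … (3) ⇒ (1). If `D` is Fredholm then (2.20)
and its analogue for `D*` show that `B_i` and `B*_i` are closed for all `i`." — here run for the Laplacian
`Δ = D*D + DD*` in one degree instead of the rolled-up operator `D`.

L. Hörmander, Acta Math. 113 (1965), §1.1 (held text `paper:doi-10-1007-bf02391775`, p0003–p0004):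
"THEOREM 1.1.1. The following conditions on `T` are equivalent: (a) `R_T` is closed. (b) There is a constant
`C` such that `‖f‖₁ ≤ C‖Tf‖₂, f ∈ D_T ∩ [R_{T*}]`. …" — applied to the self-adjoint operator `□` (`□* = □`,
`[R_□] = N_□^⊥ = 𝔥^⊥`), and "THEOREM 1.1.2. A necessary and sufficient condition for `R_T` and `R_S` both to
be closed is that `‖g‖₂² ≤ C²(‖T*g‖₁² + ‖Sg‖₃²); g ∈ D_{T*} ∩ D_S, g ⊥ N`."

## What is proved (all over `𝕜 = ℝ` or `ℂ`)

* **`isClosed_range_of_isClosed_range_laplacian`** (`Im □` closed ⇒ `Im T` and `Im S` closed: an element of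
  `cl Im T ⊆ 𝔥^⊥ = cl Im □ = Im □` is `TT*u + S*Su` with `S*Su ∈ cl Im T ∩ cl Im S* = 0`) and, with row g31-#2,
  **`isClosed_range_laplacian_iff`**; `range_laplacian_eq_orthogonal_harmonic_of_isClosed` (`Im □ = 𝔥^⊥`).
* the gap: **`norm_le_of_basic_estimate`** (under (1.1.4), `‖u‖ ≤ C²‖□u‖` and
  `norm_sq_le_mul_re_inner_laplacian` `‖u‖² ≤ C² Re(□u, u)` for `u ∈ D_□ ∩ 𝔥^⊥`),
  **`isClosed_range_laplacian_of_gap`** (Thm 1.1.1 (b) ⇒ (a) for `□`), **`exists_gap_of_isClosed_range_laplacian`**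
  ((a) ⇒ (b)), `isClosed_range_laplacian_iff_exists_gap`;
* the four-way equivalence closed: `isClosed_range_laplacian_of_basic_estimate`,
  `exists_basic_estimate_of_isClosed_range_laplacian`, **`isClosed_range_laplacian_iff_exists_basic_estimate`**,
  `isClosed_range_of_gap` (`Im T`, `Im S` closed from the gap).

## References

* [BruningLesch1992] J. Brüning, M. Lesch, *Hilbert complexes*, J. Funct. Anal. 108 (1992), §2 Thm 2.4 (proof,
  (2.17), (2.20)).
* [Hormander1965] L. Hörmander, *L² estimates and existence theorems for the ∂̄ operator*, Acta Math. 113 (1965),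
  §1.1 Thms 1.1.1–1.1.2.
* [ArnoldFalkWinther2010] D. N. Arnold, R. S. Falk, R. Winther, Bull. AMS 47 (2010), §3.1 (closed Hilbert complexes
  and the Poincaré inequality; context).
-/

noncomputable section

open scoped InnerProductSpace LinearPMap

namespace Literature.Analysis.InnerProduct

variable {𝕜 E F G : Type*} [RCLike 𝕜]
variable [NormedAddCommGroup E] [InnerProductSpace 𝕜 E] [CompleteSpace E]
variable [NormedAddCommGroup F] [InnerProductSpace 𝕜 F] [CompleteSpace F]
variable [NormedAddCommGroup G] [InnerProductSpace 𝕜 G] [CompleteSpace G]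
variable {T : E →ₗ.[𝕜] F} {S : F →ₗ.[𝕜] G} {L : F →ₗ.[𝕜] F}

omit [CompleteSpace E] [CompleteSpace F] [CompleteSpace G] in
/-- An element of two orthogonal subspaces vanishes. [folklore] -/
private theorem eq_zero_of_mem_of_isOrtho {A B : Submodule 𝕜 F} (h : A ⟂ B) {x : F} (ha : x ∈ A) (hb : x ∈ B) :
    x = 0 :=
  inner_self_eq_zero.1 (h.inner_eq ha hb)

/-! ### §1 `Im □` closed ⇔ `Im T` and `Im S` closed -/

/-- If `Im □` is closed then `Im □ = 𝔥^⊥` (`cl Im □ = 𝔥^⊥` always). [cite: BruningLesch1992, §2 Thm 2.4 (proof,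
(2.17)/(2.20)); Bei2014, §1 p. 5] -/
theorem range_laplacian_eq_orthogonal_harmonic_of_isClosed (hdT : Dense (T.domain : Set E)) (hcT : T.IsClosed)
    (hdS : Dense (S.domain : Set F)) (hcS : S.IsClosed)
    (hST : LinearMap.range T.toFun ≤ (LinearMap.ker S.toFun).map S.domain.subtype)
    (hdom : ∀ x : F, x ∈ L.domain ↔ (∃ hxT : x ∈ T†.domain, T† ⟨x, hxT⟩ ∈ T.domain) ∧
      (∃ hxS : x ∈ S.domain, S ⟨x, hxS⟩ ∈ S†.domain))
    (hval : ∀ (x : L.domain) (hxT : (x : F) ∈ T†.domain) (hTx : T† ⟨x, hxT⟩ ∈ T.domain)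
      (hxS : (x : F) ∈ S.domain) (hSx : S ⟨x, hxS⟩ ∈ S†.domain),
      L x = T ⟨T† ⟨x, hxT⟩, hTx⟩ + S† ⟨S ⟨x, hxS⟩, hSx⟩)
    (hRL : IsClosed ((LinearMap.range L.toFun : Submodule 𝕜 F) : Set F)) :
    LinearMap.range L.toFun = ((LinearMap.ker S.toFun).map S.domain.subtype ⊓ (LinearMap.ker T†.toFun).map T†.domain.subtype)ᗮ := by
  rw [← hRL.submodule_topologicalClosure_eq]
  exact closure_range_laplacian_eq_orthogonal_pmapKer hdT hcT hdS hcS hST hdom hval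

/-- **`Im □` closed ⇒ `Im T` and `Im S` closed** ("(2.20) and its analogue … show that `B_i` and `B*_i` are
closed": an `a ∈ cl Im T` lies in `𝔥^⊥ = Im □`, so `a = TT*u + S*Su` and `S*Su = a − TT*u ∈ cl Im T ∩ cl Im S* = 0`,
whence `a = TT*u ∈ Im T`; dually `cl Im S* ⊆ Im S*`, and `Im S` is closed with `Im S*` (Kato IV 5.13)).
[cite: BruningLesch1992, §2 Thm 2.4 (proof, (3) ⇒ (1))] -/
theorem isClosed_range_of_isClosed_range_laplacian (hdT : Dense (T.domain : Set E)) (hcT : T.IsClosed)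
    (hdS : Dense (S.domain : Set F)) (hcS : S.IsClosed)
    (hST : LinearMap.range T.toFun ≤ (LinearMap.ker S.toFun).map S.domain.subtype)
    (hdom : ∀ x : F, x ∈ L.domain ↔ (∃ hxT : x ∈ T†.domain, T† ⟨x, hxT⟩ ∈ T.domain) ∧
      (∃ hxS : x ∈ S.domain, S ⟨x, hxS⟩ ∈ S†.domain))
    (hval : ∀ (x : L.domain) (hxT : (x : F) ∈ T†.domain) (hTx : T† ⟨x, hxT⟩ ∈ T.domain)
      (hxS : (x : F) ∈ S.domain) (hSx : S ⟨x, hxS⟩ ∈ S†.domain),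
      L x = T ⟨T† ⟨x, hxT⟩, hTx⟩ + S† ⟨S ⟨x, hxS⟩, hSx⟩)
    (hRL : IsClosed ((LinearMap.range L.toFun : Submodule 𝕜 F) : Set F)) :
    IsClosed ((LinearMap.range T.toFun : Submodule 𝕜 F) : Set F) ∧
      IsClosed ((LinearMap.range S.toFun : Submodule 𝕜 G) : Set G) := by
  have hRLeq := range_laplacian_eq_orthogonal_harmonic_of_isClosed hdT hcT hdS hcS hST hdom hval hRL
  have horth := isOrtho_closure_range_closure_range_adjoint (T := T) hdS hcS hST
  -- every element of `𝔥^⊥` is `TT*u + S*Su`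
  have hdec : ∀ a ∈ ((LinearMap.ker S.toFun).map S.domain.subtype ⊓ (LinearMap.ker T†.toFun).map T†.domain.subtype)ᗮ, ∃ (u : L.domain) (hxT : (u : F) ∈ T†.domain)
      (hTx : T† ⟨u, hxT⟩ ∈ T.domain) (hxS : (u : F) ∈ S.domain) (hSx : S ⟨u, hxS⟩ ∈ S†.domain),
      a = T ⟨T† ⟨u, hxT⟩, hTx⟩ + S† ⟨S ⟨u, hxS⟩, hSx⟩ := by
    intro a ha
    rw [← hRLeq] at ha
    obtain ⟨u, rfl⟩ := ha
    obtain ⟨⟨hxT, hTx⟩, ⟨hxS, hSx⟩⟩ := (hdom u).1 u.2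
    exact ⟨u, hxT, hTx, hxS, hSx, hval u hxT hTx hxS hSx⟩
  constructor
  · -- `cl Im T ⊆ Im T`
    have hle : (LinearMap.range T.toFun).topologicalClosure ≤ LinearMap.range T.toFun := by
      intro a ha
      obtain ⟨u, hxT, hTx, hxS, hSx, hau⟩ := hdec a ((isOrtho_inf_closure_range hdT).symm ha)
      have hb : S† ⟨S ⟨u, hxS⟩, hSx⟩ = a - T ⟨T† ⟨u, hxT⟩, hTx⟩ := by rw [hau]; abel
      have hb0 : S† ⟨S ⟨u, hxS⟩, hSx⟩ = 0 := by
        refine eq_zero_of_mem_of_isOrtho horth ?_ (Submodule.le_topologicalClosure _ (LinearMap.mem_range_self _ _))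
        rw [hb]
        exact Submodule.sub_mem _ ha (Submodule.le_topologicalClosure _ (LinearMap.mem_range_self _ _))
      rw [hau, hb0, add_zero]
      exact LinearMap.mem_range_self _ _
    have heq : (LinearMap.range T.toFun).topologicalClosure = LinearMap.range T.toFun :=
      le_antisymm hle (Submodule.le_topologicalClosure _)
    rw [← heq]
    exact Submodule.isClosed_topologicalClosure _
  · -- `cl Im S* ⊆ Im S*`, then Kato
    have hle : (LinearMap.range S†.toFun).topologicalClosure ≤ LinearMap.range S†.toFun := by
      intro b hb
      obtain ⟨u, hxT, hTx, hxS, hSx, hbu⟩ := hdec b ((isOrtho_inf_closure_range_adjoint hdS hcS).symm hb)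
      have ha : T ⟨T† ⟨u, hxT⟩, hTx⟩ = b - S† ⟨S ⟨u, hxS⟩, hSx⟩ := by rw [hbu]; abel
      have ha0 : T ⟨T† ⟨u, hxT⟩, hTx⟩ = 0 := by
        refine eq_zero_of_mem_of_isOrtho horth (Submodule.le_topologicalClosure _ (LinearMap.mem_range_self _ _)) ?_
        rw [ha]
        exact Submodule.sub_mem _ hb (Submodule.le_topologicalClosure _ (LinearMap.mem_range_self _ _))
      rw [hbu, ha0, zero_add]
      exact LinearMap.mem_range_self _ _
    have heq : (LinearMap.range S†.toFun).topologicalClosure = LinearMap.range S†.toFun :=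
      le_antisymm hle (Submodule.le_topologicalClosure _)
    have hRS' : IsClosed ((LinearMap.range S†.toFun : Submodule 𝕜 F) : Set F) := by
      rw [← heq]; exact Submodule.isClosed_topologicalClosure _
    exact isClosed_range_of_isClosed_range_adjoint hdS hcS hRS'

/-- **`Im □` is closed iff `Im T` and `Im S` are closed.** [cite: BruningLesch1992, §2 Thm 2.4 (proof, (2.17),
(2.20), "(3) ⇒ (1)")] -/
theorem isClosed_range_laplacian_iff (hdT : Dense (T.domain : Set E)) (hcT : T.IsClosed)
    (hdS : Dense (S.domain : Set F)) (hcS : S.IsClosed)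
    (hST : LinearMap.range T.toFun ≤ (LinearMap.ker S.toFun).map S.domain.subtype)
    (hdom : ∀ x : F, x ∈ L.domain ↔ (∃ hxT : x ∈ T†.domain, T† ⟨x, hxT⟩ ∈ T.domain) ∧
      (∃ hxS : x ∈ S.domain, S ⟨x, hxS⟩ ∈ S†.domain))
    (hval : ∀ (x : L.domain) (hxT : (x : F) ∈ T†.domain) (hTx : T† ⟨x, hxT⟩ ∈ T.domain)
      (hxS : (x : F) ∈ S.domain) (hSx : S ⟨x, hxS⟩ ∈ S†.domain),
      L x = T ⟨T† ⟨x, hxT⟩, hTx⟩ + S† ⟨S ⟨x, hxS⟩, hSx⟩) :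
    IsClosed ((LinearMap.range L.toFun : Submodule 𝕜 F) : Set F) ↔
      IsClosed ((LinearMap.range T.toFun : Submodule 𝕜 F) : Set F) ∧
        IsClosed ((LinearMap.range S.toFun : Submodule 𝕜 G) : Set G) :=
  ⟨isClosed_range_of_isClosed_range_laplacian hdT hcT hdS hcS hST hdom hval,
    fun h ↦ isClosed_range_laplacian hdT hcT hdS hcS hST h.1 h.2 hdom hval⟩

/-! ### §2 The spectral gap of `□` on `𝔥^⊥` -/

omit [CompleteSpace G] in
/-- **Under the basic estimate (1.1.4), `‖u‖² ≤ C² Re(□u, u)` for `u ∈ D_□ ∩ 𝔥^⊥`** (`Re(□u, u) = ‖T*u‖² + ‖Su‖²`).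
[cite: Hormander1965, §1.1 Thm 1.1.2 (1.1.4); BruningLesch1992, §2 (2.13)–(2.14)] -/
theorem norm_sq_le_mul_re_inner_laplacian (hdT : Dense (T.domain : Set E)) (hdS : Dense (S.domain : Set F))
    (hdom : ∀ x : F, x ∈ L.domain ↔ (∃ hxT : x ∈ T†.domain, T† ⟨x, hxT⟩ ∈ T.domain) ∧
      (∃ hxS : x ∈ S.domain, S ⟨x, hxS⟩ ∈ S†.domain))
    (hval : ∀ (x : L.domain) (hxT : (x : F) ∈ T†.domain) (hTx : T† ⟨x, hxT⟩ ∈ T.domain)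
      (hxS : (x : F) ∈ S.domain) (hSx : S ⟨x, hxS⟩ ∈ S†.domain),
      L x = T ⟨T† ⟨x, hxT⟩, hTx⟩ + S† ⟨S ⟨x, hxS⟩, hSx⟩)
    {C : ℝ}
    (h14 : ∀ (g : F) (hgT : g ∈ T†.domain) (hgS : g ∈ S.domain),
      g ∈ ((LinearMap.ker S.toFun).map S.domain.subtype ⊓ (LinearMap.ker T†.toFun).map T†.domain.subtype)ᗮ →
        ‖g‖ ^ 2 ≤ C ^ 2 * (‖T† ⟨g, hgT⟩‖ ^ 2 + ‖S ⟨g, hgS⟩‖ ^ 2))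
    (u : L.domain) (hu : (u : F) ∈ ((LinearMap.ker S.toFun).map S.domain.subtype ⊓ (LinearMap.ker T†.toFun).map T†.domain.subtype)ᗮ) :
    ‖(u : F)‖ ^ 2 ≤ C ^ 2 * RCLike.re ⟪L u, (u : F)⟫_𝕜 := by
  rw [re_inner_laplacian_self hdT hdS hdom hval u]
  exact h14 u (laplacian_domain_le_adjoint_domain hdom u.2) (laplacian_domain_le_domain hdom u.2) hu

omit [CompleteSpace G] in
/-- **Under the basic estimate (1.1.4), `‖u‖ ≤ C²‖□u‖` for `u ∈ D_□ ∩ 𝔥^⊥`** (the spectral gap of `□` at `0`: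
`‖u‖² ≤ C² Re(□u, u) ≤ C²‖□u‖‖u‖`). [cite: Hormander1965, §1.1 Thm 1.1.2 (1.1.4) with Thm 1.1.1 (b) for `□`] -/
theorem norm_le_of_basic_estimate (hdT : Dense (T.domain : Set E)) (hdS : Dense (S.domain : Set F))
    (hdom : ∀ x : F, x ∈ L.domain ↔ (∃ hxT : x ∈ T†.domain, T† ⟨x, hxT⟩ ∈ T.domain) ∧
      (∃ hxS : x ∈ S.domain, S ⟨x, hxS⟩ ∈ S†.domain))
    (hval : ∀ (x : L.domain) (hxT : (x : F) ∈ T†.domain) (hTx : T† ⟨x, hxT⟩ ∈ T.domain)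
      (hxS : (x : F) ∈ S.domain) (hSx : S ⟨x, hxS⟩ ∈ S†.domain),
      L x = T ⟨T† ⟨x, hxT⟩, hTx⟩ + S† ⟨S ⟨x, hxS⟩, hSx⟩)
    {C : ℝ}
    (h14 : ∀ (g : F) (hgT : g ∈ T†.domain) (hgS : g ∈ S.domain),
      g ∈ ((LinearMap.ker S.toFun).map S.domain.subtype ⊓ (LinearMap.ker T†.toFun).map T†.domain.subtype)ᗮ →
        ‖g‖ ^ 2 ≤ C ^ 2 * (‖T† ⟨g, hgT⟩‖ ^ 2 + ‖S ⟨g, hgS⟩‖ ^ 2))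
    (u : L.domain) (hu : (u : F) ∈ ((LinearMap.ker S.toFun).map S.domain.subtype ⊓ (LinearMap.ker T†.toFun).map T†.domain.subtype)ᗮ) :
    ‖(u : F)‖ ≤ C ^ 2 * ‖L u‖ := by
  have h1 := norm_sq_le_mul_re_inner_laplacian hdT hdS hdom hval h14 u hu
  have h2 : RCLike.re ⟪L u, (u : F)⟫_𝕜 ≤ ‖L u‖ * ‖(u : F)‖ := re_inner_le_norm _ _
  have h3 : ‖(u : F)‖ * ‖(u : F)‖ ≤ C ^ 2 * ‖L u‖ * ‖(u : F)‖ := by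
    rw [← pow_two]
    calc ‖(u : F)‖ ^ 2 ≤ C ^ 2 * (‖L u‖ * ‖(u : F)‖) := h1.trans (mul_le_mul_of_nonneg_left h2 (sq_nonneg C))
      _ = C ^ 2 * ‖L u‖ * ‖(u : F)‖ := by ring
  by_cases h0 : ‖(u : F)‖ = 0
  · rw [h0]; positivity
  · exact le_of_mul_le_mul_right h3 (lt_of_le_of_ne (norm_nonneg _) (Ne.symm h0))

/-- **A gap `‖u‖ ≤ c‖□u‖` on `D_□ ∩ 𝔥^⊥` makes `Im □` closed** (Theorem 1.1.1 (b) ⇒ (a) for the closed densely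
defined `□` with `□* = □` and `[R_{□*}] = cl Im □ = 𝔥^⊥`). [cite: Hormander1965, §1.1 Thm 1.1.1 (b) ⇒ (a)] -/
theorem isClosed_range_laplacian_of_gap (hdT : Dense (T.domain : Set E)) (hcT : T.IsClosed)
    (hdS : Dense (S.domain : Set F)) (hcS : S.IsClosed)
    (hST : LinearMap.range T.toFun ≤ (LinearMap.ker S.toFun).map S.domain.subtype)
    (hdom : ∀ x : F, x ∈ L.domain ↔ (∃ hxT : x ∈ T†.domain, T† ⟨x, hxT⟩ ∈ T.domain) ∧
      (∃ hxS : x ∈ S.domain, S ⟨x, hxS⟩ ∈ S†.domain))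
    (hval : ∀ (x : L.domain) (hxT : (x : F) ∈ T†.domain) (hTx : T† ⟨x, hxT⟩ ∈ T.domain)
      (hxS : (x : F) ∈ S.domain) (hSx : S ⟨x, hxS⟩ ∈ S†.domain),
      L x = T ⟨T† ⟨x, hxT⟩, hTx⟩ + S† ⟨S ⟨x, hxS⟩, hSx⟩)
    {c : ℝ} (hgap : ∀ u : L.domain, (u : F) ∈ ((LinearMap.ker S.toFun).map S.domain.subtype ⊓ (LinearMap.ker T†.toFun).map T†.domain.subtype)ᗮ → ‖(u : F)‖ ≤ c * ‖L u‖) :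
    IsClosed ((LinearMap.range L.toFun : Submodule 𝕜 F) : Set F) := by
  have hdL := dense_laplacian_domain hdT hcT hdS hcS hST hdom hval
  have hcL := isClosed_laplacian hdT hcT hdS hcS hST hdom hval
  have hLL := adjoint_laplacian_eq hdT hcT hdS hcS hST hdom hval
  have hcl := closure_range_laplacian_eq_orthogonal_pmapKer hdT hcT hdS hcS hST hdom hval
  refine isClosed_range_of_estimate_closure_range_adjoint hdL hcL (le_max_right c 0) fun f hf ↦ ?_
  rw [hLL, hcl] at hf
  exact (hgap f hf).trans (mul_le_mul_of_nonneg_right (le_max_left c 0) (norm_nonneg _))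

/-- **If `Im □` is closed there is a gap `‖u‖ ≤ c‖□u‖` on `D_□ ∩ 𝔥^⊥`** (Theorem 1.1.1 (a) ⇒ (b) for `□`).
[cite: Hormander1965, §1.1 Thm 1.1.1 (a) ⇒ (b)] -/
theorem exists_gap_of_isClosed_range_laplacian (hdT : Dense (T.domain : Set E)) (hcT : T.IsClosed)
    (hdS : Dense (S.domain : Set F)) (hcS : S.IsClosed)
    (hST : LinearMap.range T.toFun ≤ (LinearMap.ker S.toFun).map S.domain.subtype)
    (hdom : ∀ x : F, x ∈ L.domain ↔ (∃ hxT : x ∈ T†.domain, T† ⟨x, hxT⟩ ∈ T.domain) ∧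
      (∃ hxS : x ∈ S.domain, S ⟨x, hxS⟩ ∈ S†.domain))
    (hval : ∀ (x : L.domain) (hxT : (x : F) ∈ T†.domain) (hTx : T† ⟨x, hxT⟩ ∈ T.domain)
      (hxS : (x : F) ∈ S.domain) (hSx : S ⟨x, hxS⟩ ∈ S†.domain),
      L x = T ⟨T† ⟨x, hxT⟩, hTx⟩ + S† ⟨S ⟨x, hxS⟩, hSx⟩)
    (hRL : IsClosed ((LinearMap.range L.toFun : Submodule 𝕜 F) : Set F)) :
    ∃ c : ℝ, 0 ≤ c ∧ ∀ u : L.domain, (u : F) ∈ ((LinearMap.ker S.toFun).map S.domain.subtype ⊓ (LinearMap.ker T†.toFun).map T†.domain.subtype)ᗮ → ‖(u : F)‖ ≤ c * ‖L u‖ := by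
  have hdL := dense_laplacian_domain hdT hcT hdS hcS hST hdom hval
  have hcL := isClosed_laplacian hdT hcT hdS hcS hST hdom hval
  have hLL := adjoint_laplacian_eq hdT hcT hdS hcS hST hdom hval
  have hcl := closure_range_laplacian_eq_orthogonal_pmapKer hdT hcT hdS hcS hST hdom hval
  obtain ⟨c, hc, hest⟩ := exists_estimate_of_isClosed_range hdL hcL hRL
  refine ⟨c, hc, fun u hu ↦ hest u ?_⟩
  rw [hLL, hcl]; exact hu

/-- **`Im □` is closed iff `□` has a gap on `𝔥^⊥`.** [cite: Hormander1965, §1.1 Thm 1.1.1 (a) ⇔ (b) (for `□`)] -/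
theorem isClosed_range_laplacian_iff_exists_gap (hdT : Dense (T.domain : Set E)) (hcT : T.IsClosed)
    (hdS : Dense (S.domain : Set F)) (hcS : S.IsClosed)
    (hST : LinearMap.range T.toFun ≤ (LinearMap.ker S.toFun).map S.domain.subtype)
    (hdom : ∀ x : F, x ∈ L.domain ↔ (∃ hxT : x ∈ T†.domain, T† ⟨x, hxT⟩ ∈ T.domain) ∧
      (∃ hxS : x ∈ S.domain, S ⟨x, hxS⟩ ∈ S†.domain))
    (hval : ∀ (x : L.domain) (hxT : (x : F) ∈ T†.domain) (hTx : T† ⟨x, hxT⟩ ∈ T.domain)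
      (hxS : (x : F) ∈ S.domain) (hSx : S ⟨x, hxS⟩ ∈ S†.domain),
      L x = T ⟨T† ⟨x, hxT⟩, hTx⟩ + S† ⟨S ⟨x, hxS⟩, hSx⟩) :
    IsClosed ((LinearMap.range L.toFun : Submodule 𝕜 F) : Set F) ↔
      ∃ c : ℝ, 0 ≤ c ∧ ∀ u : L.domain, (u : F) ∈ ((LinearMap.ker S.toFun).map S.domain.subtype ⊓ (LinearMap.ker T†.toFun).map T†.domain.subtype)ᗮ → ‖(u : F)‖ ≤ c * ‖L u‖ :=
  ⟨exists_gap_of_isClosed_range_laplacian hdT hcT hdS hcS hST hdom hval,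
    fun ⟨_, _, hgap⟩ ↦ isClosed_range_laplacian_of_gap hdT hcT hdS hcS hST hdom hval hgap⟩

/-! ### §3 … ⇔ the basic estimate (1.1.4) -/

/-- **(1.1.4) ⇒ `Im □` closed** (Theorem 1.1.2 gives `Im T`, `Im S` closed; or directly through the gap
`‖u‖ ≤ C²‖□u‖`). [cite: Hormander1965, §1.1 Thm 1.1.2; BruningLesch1992, §2 (2.17)] -/
theorem isClosed_range_laplacian_of_basic_estimate (hdT : Dense (T.domain : Set E)) (hcT : T.IsClosed)
    (hdS : Dense (S.domain : Set F)) (hcS : S.IsClosed)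
    (hST : LinearMap.range T.toFun ≤ (LinearMap.ker S.toFun).map S.domain.subtype)
    (hdom : ∀ x : F, x ∈ L.domain ↔ (∃ hxT : x ∈ T†.domain, T† ⟨x, hxT⟩ ∈ T.domain) ∧
      (∃ hxS : x ∈ S.domain, S ⟨x, hxS⟩ ∈ S†.domain))
    (hval : ∀ (x : L.domain) (hxT : (x : F) ∈ T†.domain) (hTx : T† ⟨x, hxT⟩ ∈ T.domain)
      (hxS : (x : F) ∈ S.domain) (hSx : S ⟨x, hxS⟩ ∈ S†.domain),
      L x = T ⟨T† ⟨x, hxT⟩, hTx⟩ + S† ⟨S ⟨x, hxS⟩, hSx⟩)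
    {C : ℝ}
    (h14 : ∀ (g : F) (hgT : g ∈ T†.domain) (hgS : g ∈ S.domain),
      g ∈ ((LinearMap.ker S.toFun).map S.domain.subtype ⊓ (LinearMap.ker T†.toFun).map T†.domain.subtype)ᗮ →
        ‖g‖ ^ 2 ≤ C ^ 2 * (‖T† ⟨g, hgT⟩‖ ^ 2 + ‖S ⟨g, hgS⟩‖ ^ 2)) :
    IsClosed ((LinearMap.range L.toFun : Submodule 𝕜 F) : Set F) :=
  isClosed_range_laplacian_of_gap hdT hcT hdS hcS hST hdom hval
    (norm_le_of_basic_estimate hdT hdS hdom hval h14)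

/-- **`Im □` closed ⇒ (1.1.4) for some constant** (`Im T`, `Im S` are closed, Theorem 1.1.2 necessity).
[cite: Hormander1965, §1.1 Thm 1.1.2; BruningLesch1992, §2 Thm 2.4 (proof)] -/
theorem exists_basic_estimate_of_isClosed_range_laplacian (hdT : Dense (T.domain : Set E)) (hcT : T.IsClosed)
    (hdS : Dense (S.domain : Set F)) (hcS : S.IsClosed)
    (hST : LinearMap.range T.toFun ≤ (LinearMap.ker S.toFun).map S.domain.subtype)
    (hdom : ∀ x : F, x ∈ L.domain ↔ (∃ hxT : x ∈ T†.domain, T† ⟨x, hxT⟩ ∈ T.domain) ∧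
      (∃ hxS : x ∈ S.domain, S ⟨x, hxS⟩ ∈ S†.domain))
    (hval : ∀ (x : L.domain) (hxT : (x : F) ∈ T†.domain) (hTx : T† ⟨x, hxT⟩ ∈ T.domain)
      (hxS : (x : F) ∈ S.domain) (hSx : S ⟨x, hxS⟩ ∈ S†.domain),
      L x = T ⟨T† ⟨x, hxT⟩, hTx⟩ + S† ⟨S ⟨x, hxS⟩, hSx⟩)
    (hRL : IsClosed ((LinearMap.range L.toFun : Submodule 𝕜 F) : Set F)) :
    ∃ C : ℝ, 0 ≤ C ∧ ∀ (g : F) (hgT : g ∈ T†.domain) (hgS : g ∈ S.domain),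
      g ∈ ((LinearMap.ker S.toFun).map S.domain.subtype ⊓ (LinearMap.ker T†.toFun).map T†.domain.subtype)ᗮ → ‖g‖ ^ 2 ≤ C ^ 2 * (‖T† ⟨g, hgT⟩‖ ^ 2 + ‖S ⟨g, hgS⟩‖ ^ 2) := by
  obtain ⟨hRT, hRS⟩ := isClosed_range_of_isClosed_range_laplacian hdT hcT hdS hcS hST hdom hval hRL
  exact exists_basic_estimate_of_isClosed_range hdT hdS hcS hST hRT hRS

/-- **`Im □` is closed iff the basic estimate (1.1.4) holds for some constant.**
[cite: Hormander1965, §1.1 Thm 1.1.2; BruningLesch1992, §2 Thm 2.4 (proof)] -/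
theorem isClosed_range_laplacian_iff_exists_basic_estimate (hdT : Dense (T.domain : Set E)) (hcT : T.IsClosed)
    (hdS : Dense (S.domain : Set F)) (hcS : S.IsClosed)
    (hST : LinearMap.range T.toFun ≤ (LinearMap.ker S.toFun).map S.domain.subtype)
    (hdom : ∀ x : F, x ∈ L.domain ↔ (∃ hxT : x ∈ T†.domain, T† ⟨x, hxT⟩ ∈ T.domain) ∧
      (∃ hxS : x ∈ S.domain, S ⟨x, hxS⟩ ∈ S†.domain))
    (hval : ∀ (x : L.domain) (hxT : (x : F) ∈ T†.domain) (hTx : T† ⟨x, hxT⟩ ∈ T.domain)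
      (hxS : (x : F) ∈ S.domain) (hSx : S ⟨x, hxS⟩ ∈ S†.domain),
      L x = T ⟨T† ⟨x, hxT⟩, hTx⟩ + S† ⟨S ⟨x, hxS⟩, hSx⟩) :
    IsClosed ((LinearMap.range L.toFun : Submodule 𝕜 F) : Set F) ↔
      ∃ C : ℝ, 0 ≤ C ∧ ∀ (g : F) (hgT : g ∈ T†.domain) (hgS : g ∈ S.domain),
        g ∈ ((LinearMap.ker S.toFun).map S.domain.subtype ⊓ (LinearMap.ker T†.toFun).map T†.domain.subtype)ᗮ → ‖g‖ ^ 2 ≤ C ^ 2 * (‖T† ⟨g, hgT⟩‖ ^ 2 + ‖S ⟨g, hgS⟩‖ ^ 2) :=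
  ⟨exists_basic_estimate_of_isClosed_range_laplacian hdT hcT hdS hcS hST hdom hval,
    fun ⟨_, _, h14⟩ ↦ isClosed_range_laplacian_of_basic_estimate hdT hcT hdS hcS hST hdom hval h14⟩

/-- **A gap for `□` on `𝔥^⊥` makes `Im T` and `Im S` closed.** [cite: BruningLesch1992, §2 Thm 2.4 (proof,
(3) ⇒ (1)); Hormander1965, §1.1 Thm 1.1.1] -/
theorem isClosed_range_of_gap (hdT : Dense (T.domain : Set E)) (hcT : T.IsClosed)
    (hdS : Dense (S.domain : Set F)) (hcS : S.IsClosed)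
    (hST : LinearMap.range T.toFun ≤ (LinearMap.ker S.toFun).map S.domain.subtype)
    (hdom : ∀ x : F, x ∈ L.domain ↔ (∃ hxT : x ∈ T†.domain, T† ⟨x, hxT⟩ ∈ T.domain) ∧
      (∃ hxS : x ∈ S.domain, S ⟨x, hxS⟩ ∈ S†.domain))
    (hval : ∀ (x : L.domain) (hxT : (x : F) ∈ T†.domain) (hTx : T† ⟨x, hxT⟩ ∈ T.domain)
      (hxS : (x : F) ∈ S.domain) (hSx : S ⟨x, hxS⟩ ∈ S†.domain),
      L x = T ⟨T† ⟨x, hxT⟩, hTx⟩ + S† ⟨S ⟨x, hxS⟩, hSx⟩)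
    {c : ℝ} (hgap : ∀ u : L.domain, (u : F) ∈ ((LinearMap.ker S.toFun).map S.domain.subtype ⊓ (LinearMap.ker T†.toFun).map T†.domain.subtype)ᗮ → ‖(u : F)‖ ≤ c * ‖L u‖) :
    IsClosed ((LinearMap.range T.toFun : Submodule 𝕜 F) : Set F) ∧
      IsClosed ((LinearMap.range S.toFun : Submodule 𝕜 G) : Set G) :=
  isClosed_range_of_isClosed_range_laplacian hdT hcT hdS hcS hST hdom hval
    (isClosed_range_laplacian_of_gap hdT hcT hdS hcS hST hdom hval hgap)

end Literature.Analysis.InnerProduct
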